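import Summits.QuantumFields.BalabanUV.Beta.B12AsPrintedRowD4Junction

/-!
# Beta / EriceFlowEnclosureB12AsPrintedUpper — the RECURSION ∕ UPPER ∕ THEOREM-2 side of the β-flow enclosure, read LITERALLY AGAINST
# THE AS-PRINTED INTERFACE OF [I]: `Balaban1983to89.B12BetaAsPrinted` (β-flow team, prover 1, unit `b2b-balaban-beta-bflow-p1`, gen 32;
# ROW AP-I of the lineage's ENCLOSURE-MAP — the [I]-side twin of row AP = gen 9's `EriceFlowEnclosureAsPrintedUpper` over the Erice
# interface `BalabanJaffe1986.BetaFlowAsPrinted`; companions: `…B12AsPrintedMarginal` ∕ `…B12AsPrintedOrientation` (orientation audit),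
# `…B12AsPrintedWitness` (consistency ∕ independence witnesses))

HONEST FRAMING (page 1 of everything the β sub-cell writes): discharging `BetaPertH` makes Bałaban's UV stability UNCONDITIONAL — a
real constructive-QFT result; it is NOT the continuum limit and NOT the Clay problem.  HONEST DEPENDENCY (cell reorg 2026-08-19,
verbatim): «continuum YM on T⁴ ⇐ BetaPertH ∧ nine spine estimates (0/9 proved); BetaPertH ⇐ (D1) ∧ (D4) ∧ CAP+tail; G-an2-4 gates
asym, D1 and NE2/3/4.»  THIS MODULE DISCHARGES NOTHING: it is bookkeeping from the NAMED FIELDS of the statement-exact typing of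
[I] = T. Bałaban, *Renormalization group approach to lattice gauge field theories. I*, Commun. Math. Phys. **109** (1987) 249–301
[Balaban1987RG1] — `B12BetaAsPrinted` (typer unit `b2b-balaban-beta-asprinted`, p537882 ✓ ∕ v1.1 p539116 ✓; `Setting S` = the printed
objects, `StandingHypotheses S` ∕ `Definitions S` ∕ `Conclusions S` = p. 251 + Theorem 3's hypotheses ∕ the printed definitions
(0.18)–(0.20), (1.3)∕(1.6), (1.20)–(1.22), (2.13)–(2.15) ∕ Theorem 3's conclusions with (5.10), (5.37)–(5.44); `RunHyp S P` =
Theorem 3's run hypothesis «defined inductively by (0.17)–(0.20)», «0 < g_k ≦ γ, k = 0, …, K»; `Theorem2Statement S hL` = Theorem 2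
∕ (0.31) BY NAME, never a conjunct) — to the tree's history-typed flow step `FlowStep` ([I] p. 298: β_{j+1} depends on g₀, …, g_j)
and to the row-D4 junction `B12AsPrintedRowD4Junction` (unit `b2b-balaban-beta-an4`, p539177 ✓) BY NAME.  Every field of the interface
enters as a HYPOTHESIS on an abstract `Setting S`; nothing of [I] is asserted; no field is claimed for Bałaban's objects.

WHAT [I] PROVES AND WHAT IT STATES (the interface's fidelity ledger `beta/CMP109-FIDELITY.md` §0, two readers + countersign): Theorem 3
(incl. the β-clause of p. 264 and, via (5.10) + (5.42), the UNIFORM BOUND |β_{j+1}(g₀, …, g_{j−1}, s)| ≦ β′ := O(1)E₀·Σ_x|x|₁²e^{−δ₁|x|₁}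
along every run with 0 < g_k ≦ γ — `B12BetaAsPrinted.beta_abs_le_of_conclusions`, `B12AsPrintedRowD4Junction.abs_beta_prefix_le_betaPrime510`)
is PROVED in [I]+[II]; Theorem 2 (the tuning g₀ = g₀(ε, g), the run in ]0, γ], the two-sided logarithmic running (0.31)) is STATED
WITHOUT PROOF (p. 259; [Balaban1989LargeFieldII] p. 355 «has not been published yet»).

WHAT THIS FILE PROVES (0 sorry, 0 def; every statement quantifies over `S : Setting` and takes interface fields as hypotheses):
§1 PRINT ALONE ⟹ THE UPPER HALF OF (0.31) ALONG EVERY RUN THEOREM 3 SPEAKS OF.  `beta_prefix_mem_Icc` (−β′ ≤ β_{j+1}(g₀, …, g_j) ≤ β′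
   at the run's own histories, j + 1 ≤ K); **`discrete031_abs_of_conclusions`** (`Definitions S → Conclusions S → RunHyp S P →
   Step.Discrete031 (−β′) β′ K g_K (g_·)`: `1∕g_K² − β′(K − k) ≤ 1∕g_k² ≤ 1∕g_K² + β′(K − k)` for every k ≤ K — the RIGHT inequality IS
   the upper half of (0.31) with β′∕ln L for the printed β′; the left one is the trivial symmetric bound, NOT the printed lower half,
   which needs the SIGN of β); `upper_running_of_conclusions`; `abs_inv_sq_sub_le` (`|1∕g_m² − 1∕g_n²| ≤ β′(n − m)`, m ≤ n ≤ K: in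
   particular the BARE and the RENORMALIZED ends differ by at most β′K in 1∕g²); **`ineq031_abs_of_conclusions`** (the same in the
   VERBATIM shape `Step.Ineq031` of (0.31) with ε = L^{−K}: `1∕g² − (β′∕ln L)·log(L^kε)⁻¹ ≤ 1∕g_k² ≤ 1∕g² + (β′∕ln L)·log(L^kε)⁻¹`).
   READING (ours): of Theorem 2's display (0.31), the right inequality is already a consequence of what [I]+[II] prove (for every run
   they speak of); the EXISTENCE of the tuned run in ]0, γ] and the LEFT inequality with β > 0 are the part not in print.
§2 PRINT + THE SIGN ∕ AF LETTER ALONG THE RUN ⟹ (0.31) FOR THAT RUN.  `discrete031_of_conclusions_of_lower` (`b ≤ β_{j+1}(g₀, …, g_j)`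
   for j < K, a displayed run-level HYPOTHESIS — print gives no sign — ⟹ `Step.Discrete031 b β′ K g_K g_·`), `ineq031_of_conclusions_of_lower`
   (verbatim shape), `run_monotone_of_sign` (β ≥ 0 along the run ⟹ g_k ≤ g_{k+1}: the bare coupling is the smallest),
   `run_le_final_of_sign` (g_k ≤ g_K).
§3 THE PRINTED DEFINITIONS FEED THE TREE'S FORWARD SHOOTING.  `flowOf_g` (the interface's run family IS `S.cpl`); `h0_of_definitions`
   ((0.18) `d018` = `FlowStep`'s `h0`); **`hfwd_of_definitions`** ((0.20) in its printed forward-determination form `d020` = `FlowStep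
   §6`'s `hfwd`, literally); hence THEOREM 2 AS PRINTED, ON THE AS-PRINTED CARRIER, FROM THE LOCATED LETTERS: **`theorem2Statement_of_letters`**
   (`StandingHypotheses S → Definitions S →` joint continuity + `0 < b ≤ β_{k+1} ≤ b′` on the boxes ]0, γ₀]^{k+1} `→ Theorem2Statement S hL`
   — `FlowStep.B12Thm2Shape_of_betaBoundsH` BY NAME), **`theorem2Statement_of_pertH`** (`FlowStep.BetaPertH S.β β̄`, β̄ > 0, + joint
   continuity ⟹ `Theorem2Statement S hL`: THE β SUB-CELL'S WALL `BetaPertH`, READ FOR THE AS-PRINTED β OF [I], DISCHARGES [I]'s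
   THEOREM 2 AS PRINTED — `FlowStep.B12Thm2Shape_of_pertH` BY NAME), `theorem2Statement_of_split` (the one-loop-split letters
   (AF-0)∕(AF-1) + upper bound + continuity — `FlowStep.B12Thm2Shape_of_split_hist`).  The box-wide letters are HYPOTHESES print
   does not supply: `Conclusions` gives the upper bound on RUN PREFIXES only (`B12AsPrintedRowD4Junction`, O-2) and continuity in the
   LAST variable only (`c264`); no sign anywhere (said plainly).
§4 WHAT THEOREM 2 AS PRINTED HANDS DOWNSTREAM, ON THIS CARRIER: **`tunedRuns_of_theorem2Statement`** (`Theorem2Statement S hL ⟹` for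
   every m: ∃ γ₀ > 0 ∀ γ ∈ ]0, γ₀] ∃ g₁ > 0 ∀ g ∈ ]0, g₁] ∃ 0 < β ≤ β′ ∀ K ∃ g₀: `Step.InInterval γ K (S.cpl ⟨K, m, g₀⟩)` ∧ `S.cpl ⟨K, m,
   g₀⟩ K = g` ∧ `Step.Discrete031 (β ln L) (β′ ln L) K g (S.cpl ⟨K, m, g₀⟩)` — (0.31) per step, `Step.logRunning_iff_discrete031`),
   `runHyp_leaf_of_theorem2Statement` (the interval leaf of [Balaban1989LargeFieldII] Thm 1 for the tuned runs: `Step.InInterval`, i.e.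
   `RunHyp.inInterval` for γ ≤ S.γ — the recursion conjunct `RunHyp.rg` is NOT among Theorem 2's printed conclusions and is not
   derived here).
§5 WHAT PRINT SUPPLIES TOWARD THE LETTERS, ALONG RUNS: `lastSection_continuousOn` (continuity in the LAST variable per step, from `c264`),
   `lastSection_lipschitzOnWith` (a Lipschitz constant in the last variable PER STEP AND PER RUN — the per-j shadow of row I1's clause; the
   k-uniform constant is row an4's located unprinted hypothesis).
NOT CLAIMED: that any field of `B12BetaAsPrinted` holds for Bałaban's objects; the lower half of (0.31) from print; `RunHyp` along the
tuned runs from Theorem 2's statement; `BetaPertH`; continuum; Clay.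
-/

namespace Summit.QuantumFields.BalabanUV.Beta.EriceFlowEnclosureB12AsPrintedUpper

open Literature.MathematicalPhysics.QuantumFieldTheory.Balaban1983to89
open Literature.MathematicalPhysics.QuantumFieldTheory.Balaban1983to89.B12BetaAsPrinted
open Literature.MathematicalPhysics.QuantumFieldTheory.Balaban1983to89.B12Sec2to5 (betaPrime510)
open Literature.MathematicalPhysics.QuantumFieldTheory.Balaban1983to89.FlowStep (prefixOf Box BetaContH BetaLowerH BetaUpperH)
open Summit.QuantumFields.BalabanUV.Beta.B12AsPrintedRowD4Junction (abs_beta_prefix_le_betaPrime510)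

noncomputable section

variable {S : Setting}

/-! ## §1 Print alone: the two-sided |·|-running, i.e. the UPPER half of (0.31), along every run Theorem 3 speaks of -/

/-- Along a run satisfying Theorem 3's hypothesis, at every step `j + 1 ≤ K`: `−β′ ≤ β_{j+1}(g₀, …, g_j) ≤ β′` with
`β′ = betaPrime510 4 (C510·E₀) δ₁` — the junction's `abs_beta_prefix_le_betaPrime510` (the typer's undisplayed line
`beta_abs_le_of_conclusions` at the run's own history) split into its two halves. [cite: Balaban1987RG1, Thm 3 p.264 with (5.10) p.293 and (5.42) p.297] -/
theorem beta_prefix_mem_Icc (hD : Definitions S) (hC : Conclusions S) {P : B12.RunParams} (hP : RunHyp S P) {j : ℕ}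
    (hj : j + 1 ≤ P.K) :
    -betaPrime510 4 (S.C510 * S.E₀) S.δ₁ ≤ S.β j (prefixOf (S.cpl P) j) ∧
      S.β j (prefixOf (S.cpl P) j) ≤ betaPrime510 4 (S.C510 * S.E₀) S.δ₁ :=
  abs_le.mp (abs_beta_prefix_le_betaPrime510 hD hC hP hj)

/-- **PRINT ALONE ⟹ THE UPPER HALF OF (0.31) ALONG EVERY RUN THEOREM 3 SPEAKS OF.**  For every setting with the printed `Definitions`
and Theorem 3's printed `Conclusions`, and every run P = (K, m, g₀) defined by (0.20) with 0 < g_k ≦ γ (k ≤ K):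
`1∕g_K² − β′(K − k) ≤ 1∕g_k² ≤ 1∕g_K² + β′(K − k)` for all k ≤ K (`Step.Discrete031 (−β′) β′`), β′ = betaPrime510 4 (C510·E₀) δ₁ —
(0.20) telescoped (`FlowStep.discrete031_of_trajBounds`) with the uniform bound of the β-clause.  The right inequality is (0.31)'s
UPPER half (with β′∕ln L for the printed constant); the left one is NOT (0.31)'s lower half (that one has `+β(K − k)`, β > 0, and
needs the sign of β, which [I] does not print). [cite: Balaban1987RG1, Thm 2 (0.31) p.259 with Thm 3 p.264 and (0.20) p.256] -/
theorem discrete031_abs_of_conclusions (hD : Definitions S) (hC : Conclusions S) {P : B12.RunParams} (hP : RunHyp S P) :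
    Step.Discrete031 (-betaPrime510 4 (S.C510 * S.E₀) S.δ₁) (betaPrime510 4 (S.C510 * S.E₀) S.δ₁) P.K (S.cpl P P.K)
      (S.cpl P) :=
  FlowStep.discrete031_of_trajBounds hP.rg (fun _ hj => (beta_prefix_mem_Icc hD hC hP (Nat.succ_le_of_lt hj)).1)
    fun _ hj => (beta_prefix_mem_Icc hD hC hP (Nat.succ_le_of_lt hj)).2

/-- The upper half alone: `1∕g_k² ≤ 1∕g_K² + β′·(K − k)`, k ≤ K. [cite: Balaban1987RG1, Thm 2 (0.31) p.259 (right inequality)] -/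
theorem upper_running_of_conclusions (hD : Definitions S) (hC : Conclusions S) {P : B12.RunParams} (hP : RunHyp S P)
    {k : ℕ} (hk : k ≤ P.K) :
    1 / (S.cpl P k) ^ 2 ≤ 1 / (S.cpl P P.K) ^ 2 + betaPrime510 4 (S.C510 * S.E₀) S.δ₁ * ((P.K : ℝ) - k) :=
  ((discrete031_abs_of_conclusions hD hC hP) k hk).2

/-- **Any two scales of one run differ by at most β′ per step in 1∕g²**: `|1∕g_m² − 1∕g_n²| ≤ β′·(n − m)` for m ≤ n ≤ K — in
particular the BARE end (m = 0) and the renormalized end (n = K): `|1∕g₀² − 1∕g_K²| ≤ β′K`.  (Telescoped (0.20)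
`FlowStep.inv_sq_telescopeH` + the uniform bound.) [cite: Balaban1987RG1, (0.20) p.256 with Thm 3 p.264] -/
theorem abs_inv_sq_sub_le (hD : Definitions S) (hC : Conclusions S) {P : B12.RunParams} (hP : RunHyp S P) {m n : ℕ}
    (hmn : m ≤ n) (hn : n ≤ P.K) :
    |1 / (S.cpl P m) ^ 2 - 1 / (S.cpl P n) ^ 2| ≤ betaPrime510 4 (S.C510 * S.E₀) S.δ₁ * ((n : ℝ) - m) := by
  have ht := FlowStep.inv_sq_telescopeH hP.rg hmn hn
  have hsum : 1 / (S.cpl P m) ^ 2 - 1 / (S.cpl P n) ^ 2 = ∑ j ∈ Finset.Ico m n, S.β j (prefixOf (S.cpl P) j) := by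
    rw [ht]; ring
  rw [hsum]
  have hcard : ((Finset.Ico m n).card : ℝ) = (n : ℝ) - m := by rw [Nat.card_Ico, Nat.cast_sub hmn]
  calc |∑ j ∈ Finset.Ico m n, S.β j (prefixOf (S.cpl P) j)|
      ≤ ∑ j ∈ Finset.Ico m n, |S.β j (prefixOf (S.cpl P) j)| := Finset.abs_sum_le_sum_abs _ _
    _ ≤ ∑ _j ∈ Finset.Ico m n, betaPrime510 4 (S.C510 * S.E₀) S.δ₁ := by
        refine Finset.sum_le_sum fun j hj => ?_
        have hjn : j < n := (Finset.mem_Ico.mp hj).2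
        exact abs_beta_prefix_le_betaPrime510 hD hC hP (Nat.succ_le_of_lt (lt_of_lt_of_le hjn hn))
    _ = betaPrime510 4 (S.C510 * S.E₀) S.δ₁ * ((n : ℝ) - m) := by
        rw [Finset.sum_const, nsmul_eq_mul, hcard, mul_comm]

/-- `1 < L` as a natural number, from p. 251's `11 < L`. [cite: Balaban1987RG1, p.251 («odd, positive integer > 11»)] -/
theorem one_lt_L (hH : StandingHypotheses S) : 1 < S.L := (hL_of_standing hH).2

/-- **The same in the VERBATIM shape of (0.31)** (`Step.Ineq031`, ε = L^{−K}): along every run Theorem 3 speaks of,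
`1∕g² − (β′∕ln L)·log(L^kε)⁻¹ ≤ 1∕g_k² ≤ 1∕g² + (β′∕ln L)·log(L^kε)⁻¹` with g = g_K — the right inequality being the printed
upper half with Theorem 2's β′ := β′∕ln L (`Step.Ineq031_iff_discrete031`). [cite: Balaban1987RG1, Thm 2 (0.31) p.259] -/
theorem ineq031_abs_of_conclusions (hH : StandingHypotheses S) (hD : Definitions S) (hC : Conclusions S)
    {P : B12.RunParams} (hP : RunHyp S P) :
    Step.Ineq031 S.L (((S.L : ℝ) ^ P.K)⁻¹) P.K (-(betaPrime510 4 (S.C510 * S.E₀) S.δ₁ / Real.log S.L))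
      (betaPrime510 4 (S.C510 * S.E₀) S.δ₁ / Real.log S.L) (S.cpl P P.K) (S.cpl P) := by
  have hL := one_lt_L hH
  have hlog : Real.log (S.L : ℝ) ≠ 0 := (Real.log_pos (by exact_mod_cast hL)).ne'
  rw [Step.Ineq031_iff_discrete031 hL, neg_mul, div_mul_cancel₀ _ hlog]
  exact discrete031_abs_of_conclusions hD hC hP

/-! ## §2 Print + the sign ∕ AF letter ALONG THE RUN: (0.31) for that run -/

/-- **(0.31) FOR ONE RUN from print + a run-level lower letter.**  If along the run `b ≤ β_{j+1}(g₀, …, g_j)` for j < K (a DISPLAYED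
HYPOTHESIS — [I] prints no sign or lower bound of β; with b > 0 it is asymptotic freedom along this run), then
`1∕g_K² + b(K − k) ≤ 1∕g_k² ≤ 1∕g_K² + β′(K − k)`, k ≤ K: the full discrete (0.31) for this run, upper constant from print.
[cite: Balaban1987RG1, Thm 2 (0.31) p.259 with Thm 3 p.264] -/
theorem discrete031_of_conclusions_of_lower (hD : Definitions S) (hC : Conclusions S) {P : B12.RunParams} (hP : RunHyp S P)
    {b : ℝ} (hlo : ∀ j, j < P.K → b ≤ S.β j (prefixOf (S.cpl P) j)) :
    Step.Discrete031 b (betaPrime510 4 (S.C510 * S.E₀) S.δ₁) P.K (S.cpl P P.K) (S.cpl P) :=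
  FlowStep.discrete031_of_trajBounds hP.rg hlo fun _ hj => (beta_prefix_mem_Icc hD hC hP (Nat.succ_le_of_lt hj)).2

/-- The same in the verbatim shape `Step.Ineq031` of (0.31) (ε = L^{−K}; Theorem 2's β := b∕ln L, β′ := β′∕ln L).
[cite: Balaban1987RG1, Thm 2 (0.31) p.259] -/
theorem ineq031_of_conclusions_of_lower (hH : StandingHypotheses S) (hD : Definitions S) (hC : Conclusions S)
    {P : B12.RunParams} (hP : RunHyp S P) {b : ℝ} (hlo : ∀ j, j < P.K → b ≤ S.β j (prefixOf (S.cpl P) j)) :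
    Step.Ineq031 S.L (((S.L : ℝ) ^ P.K)⁻¹) P.K (b / Real.log S.L)
      (betaPrime510 4 (S.C510 * S.E₀) S.δ₁ / Real.log S.L) (S.cpl P P.K) (S.cpl P) := by
  have hL := one_lt_L hH
  have hlog : Real.log (S.L : ℝ) ≠ 0 := (Real.log_pos (by exact_mod_cast hL)).ne'
  rw [Step.Ineq031_iff_discrete031 hL, div_mul_cancel₀ _ hlog, div_mul_cancel₀ _ hlog]
  exact discrete031_of_conclusions_of_lower hD hC hP hlo

/-- **The sign alone orders the run**: if `0 ≤ β_{j+1}(g₀, …, g_j)` for j < K along a run Theorem 3 speaks of, then `g_k ≤ g_{k+1}`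
(k < K) — the bare coupling is the smallest, the renormalized one the largest. [cite: Balaban1987RG1, (0.20) p.256 with Thm 2 p.259] -/
theorem run_monotone_of_sign {P : B12.RunParams} (hP : RunHyp S P)
    (hsign : ∀ j, j < P.K → 0 ≤ S.β j (prefixOf (S.cpl P) j)) {k : ℕ} (hk : k < P.K) :
    S.cpl P k ≤ S.cpl P (k + 1) := by
  have hk0 := hP.inInterval k hk.le
  have hk1 := hP.inInterval (k + 1) hk
  have hrg := hP.rg k hk
  have hle : 1 / (S.cpl P (k + 1)) ^ 2 ≤ 1 / (S.cpl P k) ^ 2 := by rw [hrg]; linarith [hsign k hk]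
  have hsq : (S.cpl P k) ^ 2 ≤ (S.cpl P (k + 1)) ^ 2 :=
    (one_div_le_one_div (pow_pos hk1.1 2) (pow_pos hk0.1 2)).mp hle
  nlinarith [hk0.1, hk1.1]

/-- … hence `g_k ≤ g_n` for k ≤ n ≤ K, [cite: Balaban1987RG1, (0.20) p.256 with Thm 2 p.259] -/
theorem run_le_of_sign {P : B12.RunParams} (hP : RunHyp S P)
    (hsign : ∀ j, j < P.K → 0 ≤ S.β j (prefixOf (S.cpl P) j)) {k n : ℕ} (hkn : k ≤ n) (hn : n ≤ P.K) :
    S.cpl P k ≤ S.cpl P n := by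
  induction n, hkn using Nat.le_induction with
  | base => exact le_rfl
  | succ n hkn ih =>
    exact (ih (Nat.le_of_succ_le hn)).trans (run_monotone_of_sign hP hsign (Nat.lt_of_succ_le hn))

/-- … and `g_k ≤ g_K = g` for every k ≤ K: along an asymptotically free run the renormalized coupling bounds all effective couplings.
[cite: Balaban1987RG1, (0.20) p.256 with Thm 2 p.259] -/
theorem run_le_final_of_sign {P : B12.RunParams} (hP : RunHyp S P)
    (hsign : ∀ j, j < P.K → 0 ≤ S.β j (prefixOf (S.cpl P) j)) {k : ℕ} (hk : k ≤ P.K) :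
    S.cpl P k ≤ S.cpl P P.K :=
  run_le_of_sign hP hsign hk le_rfl

/-! ## §3 The printed definitions feed the tree's forward shooting: Theorem 2 AS PRINTED from the located letters -/

/-- The interface's run family IS the setting's coupling table: `(flowOf S P g₀).g = S.cpl ⟨P.K, P.m, g₀⟩`. [cite: Balaban1987RG1, (0.20) p.256] -/
theorem flowOf_g (S : Setting) (P : Params) (g₀ : ℝ) : (flowOf S P g₀).g = S.cpl ⟨P.K, P.m, g₀⟩ := rfl

/-- (0.18) `Definitions.d018` is `FlowStep` §6's `h0`: every run starts at its bare coupling. [cite: Balaban1987RG1, (0.17)–(0.18) p.255] -/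
theorem h0_of_definitions (hD : Definitions S) (P : Params) (g₀ : ℝ) : (flowOf S P g₀).g 0 = g₀ :=
  hD.d018 ⟨P.K, P.m, g₀⟩

/-- **(0.20) in its printed forward-determination form `Definitions.d020` is `FlowStep` §6's `hfwd`, literally**: whenever the run is
positive up to step k < K and `1∕g_k² − β_{k+1}(g₀, …, g_k) > 0`, the next coupling is THE positive solution of (0.20).
[cite: Balaban1987RG1, (0.20) p.256 with (2.15) p.268] -/
theorem hfwd_of_definitions (hD : Definitions S) (P : Params) (g₀ : ℝ) (k : ℕ) (hk : k < P.K)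
    (hpos : ∀ i, i ≤ k → 0 < (flowOf S P g₀).g i)
    (hrhs : 0 < 1 / ((flowOf S P g₀).g k) ^ 2 - S.β k (prefixOf (flowOf S P g₀).g k)) :
    0 < (flowOf S P g₀).g (k + 1) ∧
      1 / ((flowOf S P g₀).g (k + 1)) ^ 2 = 1 / ((flowOf S P g₀).g k) ^ 2 - S.β k (prefixOf (flowOf S P g₀).g k) := by
  obtain ⟨h1, h2⟩ := hD.d020 ⟨P.K, P.m, g₀⟩ k hk hpos hrhs
  refine ⟨h1, ?_⟩
  simp only [flowOf_g]
  linarith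

/-- **THEOREM 2 AS PRINTED, ON THE AS-PRINTED CARRIER, FROM THE THREE LOCATED LETTERS.**  For every setting with p. 251's ∕ Theorem 3's
standing hypotheses (only `11 < L` is used) and the printed `Definitions` ((0.18), (0.20)): if the history-dependent β-functions
`S.β` are jointly continuous on the boxes ]0, γ₀]^{k+1} and obey `0 < b ≤ β_{k+1} ≤ b′` there (the LOCATED UNPRINTED INPUT: [I] prints
no sign; `Conclusions` gives the upper bound on run prefixes only and continuity in the last variable only), then
`Theorem2Statement S hL` — [I] Theorem 2 ∕ (0.31) verbatim for the run family (0.20) defines — holds: `FlowStep.B12Thm2Shape_of_betaBoundsH`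
(forward shooting in g₀ + forward uniqueness) BY NAME, fed by `h0_of_definitions` ∕ `hfwd_of_definitions`.  A REDUCTION; nothing of
[I] asserted. [cite: Balaban1987RG1, Thm 2 (0.31) p.259 with (0.20) p.256 and p.298] -/
theorem theorem2Statement_of_letters (hH : StandingHypotheses S) (hD : Definitions S) {γ₀ b b' : ℝ} (hγ₀ : 0 < γ₀)
    (hb : 0 < b) (hbb' : b ≤ b') (hcont : BetaContH γ₀ S.β) (hlo : BetaLowerH b γ₀ S.β) (hup : BetaUpperH b' γ₀ S.β) :
    Theorem2Statement S (hL_of_standing hH) :=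
  FlowStep.B12Thm2Shape_of_betaBoundsH S.L (hL_of_standing hH) (flowOf S) S.β hγ₀ hb hbb' hcont hlo hup
    (h0_of_definitions hD) (hfwd_of_definitions hD)

/-- **THE β SUB-CELL'S WALL, READ FOR THE AS-PRINTED β OF [I], DISCHARGES [I]'s THEOREM 2 AS PRINTED.**  `FlowStep.BetaPertH S.β β̄`
(|β_{k+1}(g₀, …, g_k) − β̄| ≤ Cγ² on the boxes ]0, γ]^{k+1}, γ ≤ γ₀) with β̄ > 0, plus joint continuity on some box family ]0, γ_c]^{k+1},
plus the printed `Definitions` ⟹ `Theorem2Statement S hL` (`FlowStep.B12Thm2Shape_of_pertH` BY NAME).  HONEST: `BetaPertH` is the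
located unprinted input (BetaPertH ⇐ (D1) ∧ (D4) ∧ CAP+tail, none discharged); with the rigidity caveat of `FlowStep` §5 (a
k-independent β̄ forces constant one-loop coefficients). [cite: Balaban1989LargeFieldII, Thm 1 p.355; Balaban1987RG1, Thm 2 p.259] -/
theorem theorem2Statement_of_pertH (hH : StandingHypotheses S) (hD : Definitions S) {βbar γc : ℝ} (hbar : 0 < βbar)
    (hpert : FlowStep.BetaPertH S.β βbar) (hγc : 0 < γc) (hcont : BetaContH γc S.β) :
    Theorem2Statement S (hL_of_standing hH) :=
  FlowStep.B12Thm2Shape_of_pertH S.L (hL_of_standing hH) (flowOf S) S.β hbar hpert hγc hcont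
    (h0_of_definitions hD) (hfwd_of_definitions hD)

/-- **… and from the one-loop-split letters.**  A one-loop split `T` of `S.β` (`B12Beta.OneLoopSplit`: β = β⁰ + β¹, β¹ = 0 at g_k = 0 —
the row-D4 junction supplies one RELATIVISED to the printed coupling domain, `B12AsPrintedRowD4Junction.split_on_histDom`) with (AF-0)
`2b ≤ β⁰_{k+1}` (b > 0), (AF-1) `|β¹_{k+1}| ≤ C·g_k` on ]0, γ]^{k+1}, `Cγ ≤ b`, an upper bound and joint continuity ⟹ `Theorem2Statement S hL`
(`FlowStep.B12Thm2Shape_of_split_hist` BY NAME).  (AF-0)∕(AF-1) are NOT printed. [cite: Balaban1987RG1, Thm 2 p.259 with (2.12)–(2.14) p.268] -/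
theorem theorem2Statement_of_split (hH : StandingHypotheses S) (hD : Definitions S) (T : B12Beta.OneLoopSplit S.β)
    {b C γ β' : ℝ} (hγ0 : 0 < γ) (hb : 0 < b) (hAF0 : ∀ k, 2 * b ≤ T.β0 k)
    (hAF1 : ∀ k (p : Fin (k + 1) → ℝ), p ∈ B12Beta.HistBox γ k → |T.β1 k p| ≤ C * p (Fin.last k))
    (hC : 0 ≤ C) (hγ : C * γ ≤ b) (hU : BetaUpperH β' γ S.β) (hcont : BetaContH γ S.β) :
    Theorem2Statement S (hL_of_standing hH) :=
  FlowStep.B12Thm2Shape_of_split_hist S.L (hL_of_standing hH) (flowOf S) T hγ0 hb hAF0 hAF1 hC hγ hU hcont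
    (h0_of_definitions hD) (hfwd_of_definitions hD)

/-! ## §4 What Theorem 2 AS PRINTED hands downstream, on this carrier -/

/-- **THEOREM 2 AS PRINTED, UNFOLDED ON THE AS-PRINTED CARRIER.**  `Theorem2Statement S hL` says, for the setting's own coupling table
`S.cpl`: for every torus exponent m there is γ₀ > 0 such that for every γ ∈ ]0, γ₀] there is g₁ > 0 such that for every renormalized
g ∈ ]0, g₁] there are constants 0 < β ≤ β′ such that for EVERY number of steps K (ε = L^{−K}) some bare coupling g₀ = g₀(ε, g) gives a
run (K, m, g₀) inside ]0, γ] with g_K = g and the per-step (0.31): `1∕g² + β ln L·(K − k) ≤ 1∕g_k² ≤ 1∕g² + β′ ln L·(K − k)`, k ≤ K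
(`Step.logRunning_iff_discrete031`). [cite: Balaban1987RG1, Thm 2 (0.31) p.259] -/
theorem tunedRuns_of_theorem2Statement {hL : Odd S.L ∧ 1 < S.L} (h : Theorem2Statement S hL) (m : ℕ) :
    ∃ γ₀ : ℝ, 0 < γ₀ ∧ ∀ γ : ℝ, 0 < γ → γ ≤ γ₀ → ∃ g₁ : ℝ, 0 < g₁ ∧ ∀ g : ℝ, 0 < g → g ≤ g₁ →
      ∃ β β' : ℝ, 0 < β ∧ β ≤ β' ∧ ∀ K : ℕ, ∃ g₀ : ℝ,
        Step.InInterval γ K (S.cpl ⟨K, m, g₀⟩) ∧ S.cpl ⟨K, m, g₀⟩ K = g ∧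
          Step.Discrete031 (β * Real.log S.L) (β' * Real.log S.L) K g (S.cpl ⟨K, m, g₀⟩) := by
  obtain ⟨γ₀, hγ₀, hγ⟩ := h m
  refine ⟨γ₀, hγ₀, fun γ hγpos hγle => ?_⟩
  obtain ⟨g₁, hg₁, hg⟩ := hγ γ hγpos hγle
  refine ⟨g₁, hg₁, fun g hgpos hgle => ?_⟩
  obtain ⟨β, β', hβ, hββ', hK⟩ := hg g hgpos hgle
  refine ⟨β, β', hβ, hββ', fun K => ?_⟩
  obtain ⟨g₀, hI, hend, hlog⟩ := hK K
  refine ⟨g₀, hI, hend, ?_⟩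
  exact (Step.logRunning_iff_discrete031 _ _ g β β').mp hlog

/-- **The interval leaf of [Balaban1989LargeFieldII] Thm 1 for the tuned runs** (`Missing.inInterval_of_B12Thm2Shape` on this carrier):
Theorem 2 AS PRINTED gives, for γ small and g small, at every K a bare coupling whose run stays in ]0, γ] and ends at g — i.e. the
`inInterval` half of `RunHyp S ⟨K, m, g₀⟩` whenever γ ≤ S.γ (`Step.InInterval` is monotone in γ).  The recursion half `RunHyp.rg`
((0.20) along the run) is NOT among Theorem 2's printed conclusions and is not derived here. [cite: Balaban1989LargeFieldII, Thm 1 p.355; Balaban1987RG1, Thm 2 p.259] -/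
theorem runHyp_leaf_of_theorem2Statement {hL : Odd S.L ∧ 1 < S.L} (h : Theorem2Statement S hL) (m : ℕ) :
    ∃ γ₀ : ℝ, 0 < γ₀ ∧ ∀ γ : ℝ, 0 < γ → γ ≤ γ₀ → γ ≤ S.γ → ∃ g₁ : ℝ, 0 < g₁ ∧ ∀ g : ℝ, 0 < g → g ≤ g₁ →
      ∀ K : ℕ, ∃ g₀ : ℝ, Step.InInterval S.γ K (S.cpl ⟨K, m, g₀⟩) ∧ S.cpl ⟨K, m, g₀⟩ K = g := by
  obtain ⟨γ₀, hγ₀, hγ⟩ := tunedRuns_of_theorem2Statement h m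
  refine ⟨γ₀, hγ₀, fun γ hγpos hγle hγS => ?_⟩
  obtain ⟨g₁, hg₁, hg⟩ := hγ γ hγpos hγle
  refine ⟨g₁, hg₁, fun g hgpos hgle K => ?_⟩
  obtain ⟨β, β', -, -, hK⟩ := hg g hgpos hgle
  obtain ⟨g₀, hI, hend, -⟩ := hK K
  exact ⟨g₀, fun k hk => ⟨(hI k hk).1, (hI k hk).2.trans hγS⟩, hend⟩

/-! ## §5 What print supplies toward the letters, along runs: the last-variable clause per step -/

/-- p. 264's β-clause AS TYPED gives, per step j + 1 ≤ K of a run Theorem 3 speaks of, CONTINUITY of s ↦ β_{j+1}(g₀, …, g_{j−1}, s) on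
[0, γ] (`c264`'s smoothness, order 0) — continuity in the LAST variable at the run's own history; the JOINT continuity on the boxes
(`FlowStep.BetaContH`, §3's letter) is not printed. [cite: Balaban1987RG1, p.264 (β-clause after (1.22))] -/
theorem lastSection_continuousOn (hC : Conclusions S) {P : B12.RunParams} (hP : RunHyp S P) {j : ℕ} (hj : j + 1 ≤ P.K) :
    ContinuousOn (lastSection S P j) (Set.Icc 0 S.γ) :=
  ((hC.c264 P hP j hj).1 0).continuousOn

/-- **… and a LIPSCHITZ constant in the last variable, PER STEP AND PER RUN**: `c264` (C¹ on [0, γ] + one bound on the first derivative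
over the interval) ⟹ `∃ C_j, LipschitzOnWith C_j (s ↦ β_{j+1}(g₀, …, g_{j−1}, s)) [0, γ]` — the mean-value inequality
(`Convex.lipschitzOnWith_of_nnnorm_derivWithin_le`).  This is the per-j, per-run shadow of row I1's clause `BetaDerivClause.LastVarLipschitz`;
its k-UNIFORM constant (row an4's located hypothesis) is NOT printed and not derived. [cite: Balaban1987RG1, p.264 (β-clause after (1.22))] -/
theorem lastSection_lipschitzOnWith (hC : Conclusions S) {P : B12.RunParams} (hP : RunHyp S P) {j : ℕ} (hj : j + 1 ≤ P.K) :
    ∃ C : NNReal, LipschitzOnWith C (lastSection S P j) (Set.Icc 0 S.γ) := by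
  obtain ⟨B, hB⟩ := (hC.c264 P hP j hj).2.2 1
  have hdiff : DifferentiableOn ℝ (lastSection S P j) (Set.Icc 0 S.γ) := ((hC.c264 P hP j hj).1 1).differentiableOn (by norm_num)
  refine ⟨⟨max B 0, le_max_right _ _⟩, (convex_Icc 0 S.γ).lipschitzOnWith_of_nnnorm_derivWithin_le hdiff fun s hs => ?_⟩
  have h := hB s hs
  rw [iteratedDerivWithin_one] at h
  change ‖derivWithin (lastSection S P j) (Set.Icc 0 S.γ) s‖ ≤ max B 0
  exact h.trans (le_max_left _ _)

end

end Summit.QuantumFields.BalabanUV.Beta.EriceFlowEnclosureB12AsPrintedUpper
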